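import Literature.Algebra.EuclideanLattices.RegevRoutineParse
import Literature.Computability.QuantumComplexity.GadgetDesc
import Literature.Computability.QuantumComplexity.ShiftedCleanBlockDesc
import Literature.Computability.Complexity.IsqrtBrick
import HarnessLib

/-!
# Regev's per-copy routine as a circuit family, XIII: the family is uniform

Thirteenth file of the construction discharging `usvp_of_dihedralCoset` (layout I, programs II,
circuits IV `RegevRoutineQuantum.lean`): **`family_isUniform`** — for a parameter set whose
solver family is polynomial-time uniform, the family `family P` of the routine is polynomial-time
uniform. By `QCircuitFamily.isUniform_of_descFn_mem_FP` it suffices that the description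
`1ᴸ ↦ ⟨bin L, ⟨1^{anc L}, encode (circ L)⟩⟩` is in `FP`. The circuit is the Hadamard layer on the
coin wires, the compiled classical program `prog P L (nOf L)` and the solver's circuit at
`ℓ = ell (nOf L)` verbatim on the front wires; its description is printed at the string level with
the toolkit of `QuantumComplexity/GadgetDesc.lean` from the record `⟨1ᴸ, 1ⁿ⟩`, `n = nOf L`
(`prepF`, by the integer square root brick `isqrtFn`):

* the sizes and offsets of the layout as polynomials of `L` (`rmaxPoly`, …, `WtotPoly`) and as
  numeral expressions over the record variables `RV` (`L`, `n`, and up to three loop indices),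
  with the projection families `π0 … π3` of the nested records;
* the two garbage-free blocks by `RevClean.flatMap_opBits_cleanOps_shift_mem_FP` (`blockW`,
  `blockV`), the swap / `NOT` / copy layers of `body` and `progInit` by the leveled layers of the
  toolkit (the erase layers `progEix`, `progET` read the guarded result wires `tV`, a branching on
  a length comparison), the loop over the registers by one more layer: `progB_fn`;
* the Hadamard layer zone by zone (`hB_fn`), the solver's description by its own description
  function (`solvF`), the ancilla count `1^{Wtot L − L}`; `family_isUniform`.

(Arora–Barak 2009, §6.2 Def. 6.12 and Remark 6.7; Bernstein–Vazirani 1997, §8.)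

## References

* O. Regev, *Quantum computation and lattice problems*, SIAM J. Comput. 33 (2004), 738–760,
  proof of Lemma 3.12 and of Thm. 1.1 (the algorithm is efficient).
* S. Arora, B. Barak, *Computational Complexity: A Modern Approach*, CUP 2009, §6.2, Remark 6.7.
* E. Bernstein, U. Vazirani, *Quantum complexity theory*, SIAM J. Comput. 26 (1997), §8.
-/

noncomputable section

namespace Literature.Algebra.EuclideanLattices

namespace RegevRoutine

open _root_.Computability Polynomial Literature.Computability.Complexity Literature.Computability.Complexity.Brick
  Literature.Computability.Complexity.Plumb Literature.Computability.Cryptography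
  Literature.Computability.QuantumComplexity Literature.Computability.QuantumComplexity.ZoneGadgets
  Literature.Computability.QuantumComplexity.GadgetDesc Literature.Computability.QuantumComplexity.RevDesc
  Literature.Computability.QuantumComplexity.RevSim Literature.Computability.QuantumComplexity.RevClean
  Turing

variable (P : Params)

/-! ### The sizes and offsets as polynomials of `L` -/

/-- `rmax` as a polynomial. [folklore] -/
def rmaxPoly : Polynomial ℕ := P.pr.comp ellPoly + 1
/-- `bS` as a polynomial. [folklore] -/
def bSPoly : Polynomial ℕ := P.pD.comp ellPoly + ellPoly + rmaxPoly P * sigPoly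
/-- `A0` as a polynomial. [folklore] -/
def A0Poly : Polynomial ℕ := bSPoly P + X
/-- `oIx` as a polynomial. [folklore] -/
def oIxPoly : Polynomial ℕ := A0Poly P + (X + 1)
/-- `oV` as a polynomial. [folklore] -/
def oVPoly : Polynomial ℕ := oIxPoly P + P.pkap
/-- `oTa` as a polynomial. [folklore] -/
def oTaPoly : Polynomial ℕ := oVPoly P + (X + 1)
/-- `oWz` as a polynomial. [folklore] -/
def oWzPoly : Polynomial ℕ := oTaPoly P + sigPoly
/-- `oGz` as a polynomial. [folklore] -/
def oGzPoly : Polynomial ℕ := oWzPoly P + X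
/-- `oZ` as a polynomial. [folklore] -/
def oZPoly : Polynomial ℕ := oGzPoly P + P.pgam
/-- `NNW` as a polynomial. [folklore] -/
def NNWPoly : Polynomial ℕ := (NNPoly P.eW P.MW).comp (n0WPoly P.sizes)
/-- `copyW` as a polynomial. [folklore] -/
def copyWPoly : Polynomial ℕ := (copyNPoly P.eW P.MW).comp (n0WPoly P.sizes)
/-- `n0V` as a polynomial: `ancN(n0W) + (n0W − (L+1) − kap) + copyW`. [folklore] -/
def n0VPoly : Polynomial ℕ :=
  (ancNPoly P.MW.tm P.eW).comp (n0WPoly P.sizes) + ((X + 1) + sigPoly + X + P.pgam + zetPoly P.sizes) + copyWPoly P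
/-- `widthV` as a polynomial. [folklore] -/
def widthVPoly : Polynomial ℕ := (widthPoly P.eV P.MV).comp (n0VPoly P)
/-- `NNV` as a polynomial. [folklore] -/
def NNVPoly : Polynomial ℕ := (NNPoly P.eV P.MV).comp (n0VPoly P)
/-- `JJ` of the block `V` as a polynomial. [folklore] -/
def JJVPoly : Polynomial ℕ := (JJPoly P.eV P.MV).comp (n0VPoly P)
/-- `oT` as a polynomial. [folklore] -/
def oTPoly : Polynomial ℕ := oVPoly P + widthVPoly P
/-- `cBase` as a polynomial. [folklore] -/
def cBasePoly : Polynomial ℕ := oTPoly P + sigPoly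
/-- `cW` as a polynomial. [folklore] -/
def cWPoly : Polynomial ℕ := P.pkap + sigPoly
/-- `gBase` as a polynomial. [folklore] -/
def gBasePoly : Polynomial ℕ := cBasePoly P + rmaxPoly P * cWPoly P
/-- `gtBase` as a polynomial. [folklore] -/
def gtBasePoly : Polynomial ℕ := gBasePoly P + rmaxPoly P * copyWPoly P
/-- `Wtot` as a polynomial. [folklore] -/
def WtotPoly : Polynomial ℕ := gtBasePoly P + rmaxPoly P * sigPoly

variable {P}

/-- Value of `rmaxPoly`. [folklore] -/
@[simp] theorem eval_rmaxPoly (L : ℕ) : (rmaxPoly P).eval L = rmax P L := by simp [rmaxPoly, rmax, eval_comp]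
/-- Value of `bSPoly`. [folklore] -/
@[simp] theorem eval_bSPoly (L : ℕ) : (bSPoly P).eval L = bS P L := by simp [bSPoly, bS, eval_comp, sig]
/-- Value of `A0Poly`. [folklore] -/
@[simp] theorem eval_A0Poly (L : ℕ) : (A0Poly P).eval L = A0 P L := by simp [A0Poly, A0]
/-- Value of `oIxPoly`. [folklore] -/
@[simp] theorem eval_oIxPoly (L : ℕ) : (oIxPoly P).eval L = oIx P L := by simp [oIxPoly, oIx, oU]
/-- Value of `oVPoly`. [folklore] -/
@[simp] theorem eval_oVPoly (L : ℕ) : (oVPoly P).eval L = oV P L := by simp [oVPoly, oV, kap]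
/-- Value of `oTaPoly`. [folklore] -/
@[simp] theorem eval_oTaPoly (L : ℕ) : (oTaPoly P).eval L = oTa P L := by simp [oTaPoly, oTa]
/-- Value of `oWzPoly`. [folklore] -/
@[simp] theorem eval_oWzPoly (L : ℕ) : (oWzPoly P).eval L = oWz P L := by simp [oWzPoly, oWz]
/-- Value of `oGzPoly`. [folklore] -/
@[simp] theorem eval_oGzPoly (L : ℕ) : (oGzPoly P).eval L = oGz P L := by simp [oGzPoly, oGz]
/-- Value of `oZPoly`. [folklore] -/
@[simp] theorem eval_oZPoly (L : ℕ) : (oZPoly P).eval L = oZ P L := by simp [oZPoly, oZ, gam]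
/-- Value of `NNWPoly`. [folklore] -/
@[simp] theorem eval_NNWPoly (L : ℕ) : (NNWPoly P).eval L = NNW P L := by simp [NNWPoly, NNW, eval_comp]
/-- Value of `copyWPoly`. [folklore] -/
@[simp] theorem eval_copyWPoly (L : ℕ) : (copyWPoly P).eval L = copyW P L := by simp [copyWPoly, copyW, eval_comp]
/-- Value of `n0VPoly`. [folklore] -/
@[simp] theorem eval_n0VPoly (L : ℕ) : (n0VPoly P).eval L = n0V P L := by
  have h1 := oV_add_n0V (P := P) L
  have h2 : NNW P L = n0W P L + ancN P.MW.tm P.eW (n0W P L) := rfl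
  have h3 : widthW P L = NNW P L + copyW P L := rfl
  have h4 : oV P L = A0 P L + (L + 1) + kap P L := rfl
  have h5 : n0W P L = (L + 1) + kap P L + (L + 1) + sig L + L + gam P L + zet P L := rfl
  have h6 : (n0VPoly P).eval L = ancN P.MW.tm P.eW (n0W P L) + ((L + 1) + sig L + L + gam P L + zet P L) + copyW P L := by
    simp [n0VPoly, eval_comp, gam]
  omega
/-- Value of `widthVPoly`. [folklore] -/
@[simp] theorem eval_widthVPoly (L : ℕ) : (widthVPoly P).eval L = widthV P L := by simp [widthVPoly, widthV, eval_comp]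
/-- Value of `NNVPoly`. [folklore] -/
@[simp] theorem eval_NNVPoly (L : ℕ) : (NNVPoly P).eval L = NNV P L := by simp [NNVPoly, NNV, eval_comp]
/-- Value of `JJVPoly`. [folklore] -/
@[simp] theorem eval_JJVPoly (L : ℕ) : (JJVPoly P).eval L = JJ P.eV P.MV (n0V P L) := by simp [JJVPoly, eval_comp]
/-- Value of `oTPoly`. [folklore] -/
@[simp] theorem eval_oTPoly (L : ℕ) : (oTPoly P).eval L = oT P L := by simp [oTPoly, oT]
/-- Value of `cBasePoly`. [folklore] -/
@[simp] theorem eval_cBasePoly (L : ℕ) : (cBasePoly P).eval L = cBase P L := by simp [cBasePoly, cBase]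
/-- Value of `cWPoly`. [folklore] -/
@[simp] theorem eval_cWPoly (L : ℕ) : (cWPoly P).eval L = cW P L := by simp [cWPoly, cW, kap]
/-- Value of `gBasePoly`. [folklore] -/
@[simp] theorem eval_gBasePoly (L : ℕ) : (gBasePoly P).eval L = gBase P L := by simp [gBasePoly, gBase]
/-- Value of `gtBasePoly`. [folklore] -/
@[simp] theorem eval_gtBasePoly (L : ℕ) : (gtBasePoly P).eval L = gtBase P L := by simp [gtBasePoly, gtBase]
/-- Value of `WtotPoly`. [folklore] -/
@[simp] theorem eval_WtotPoly (L : ℕ) : (WtotPoly P).eval L = Wtot P L := by simp [WtotPoly, Wtot]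

/-! ### The record variables and their projections -/

/-- The variables of the records `⟨…⟨⟨1ᴸ, 1ⁿ⟩, 1^{x₁}⟩…, 1^{x₃}⟩`: the input length, the dimension
and up to three loop indices. [folklore] -/
inductive RV where
  | vL | vN | i1 | i2 | i3
  deriving DecidableEq

open RV

/-- The empty projection (for the indices of deeper levels). [folklore] -/
def zeroP : Proj := ⟨fun _ => [], const_mem_FP _, fun _ => Nat.zero_le _⟩

/-- The projections of the level-`0` record `⟨1ᴸ, 1ⁿ⟩`. [folklore] -/
def π0 : RV → Proj
  | vL => Proj.fstP
  | vN => Proj.sndP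
  | _ => zeroP

/-- The projections of the level-`1` record `⟨⟨1ᴸ, 1ⁿ⟩, 1^{x₁}⟩`. [folklore] -/
def π1 : RV → Proj
  | vL => Proj.fstP.comp Proj.fstP
  | vN => Proj.sndP.comp Proj.fstP
  | i1 => Proj.sndP
  | _ => zeroP

/-- The projections of the level-`2` record. [folklore] -/
def π2 : RV → Proj
  | vL => Proj.fstP.comp (Proj.fstP.comp Proj.fstP)
  | vN => Proj.sndP.comp (Proj.fstP.comp Proj.fstP)
  | i1 => Proj.sndP.comp Proj.fstP
  | i2 => Proj.sndP
  | i3 => zeroP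

/-- The projections of the level-`3` record. [folklore] -/
def π3 : RV → Proj
  | vL => Proj.fstP.comp (Proj.fstP.comp (Proj.fstP.comp Proj.fstP))
  | vN => Proj.sndP.comp (Proj.fstP.comp (Proj.fstP.comp Proj.fstP))
  | i1 => Proj.sndP.comp (Proj.fstP.comp Proj.fstP)
  | i2 => Proj.sndP.comp Proj.fstP
  | i3 => Proj.sndP

/-- The level-`0` environment of `⟨z, u⟩`: the input length. [folklore] -/
@[simp] theorem envOf_π0_vL (z u : List Bool) : NExpr.envOf π0 (boolPair z u) vL = z.length := by
  simp [NExpr.envOf, π0, Proj.fstP]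

/-- The level-`0` environment of `⟨z, u⟩`: the dimension. [folklore] -/
@[simp] theorem envOf_π0_vN (z u : List Bool) : NExpr.envOf π0 (boolPair z u) vN = u.length := by
  simp [NExpr.envOf, π0, Proj.sndP]

/-- Level `1` over level `0`. [folklore] -/
theorem envOf_π1 (r : List Bool) (t : ℕ) : NExpr.envOf π1 (boolPair r (ones t)) = Function.update (NExpr.envOf π0 r) i1 t := by
  funext x; cases x <;> simp [NExpr.envOf, π0, π1, zeroP, Proj.fstP, Proj.sndP, Proj.comp, ones, Function.update]

/-- Level `2` over level `1`. [folklore] -/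
theorem envOf_π2 (r : List Bool) (t : ℕ) : NExpr.envOf π2 (boolPair r (ones t)) = Function.update (NExpr.envOf π1 r) i2 t := by
  funext x; cases x <;> simp [NExpr.envOf, π1, π2, zeroP, Proj.fstP, Proj.sndP, Proj.comp, ones, Function.update]

/-- Level `3` over level `2`. [folklore] -/
theorem envOf_π3 (r : List Bool) (t : ℕ) : NExpr.envOf π3 (boolPair r (ones t)) = Function.update (NExpr.envOf π2 r) i3 t := by
  funext x; cases x <;> simp [NExpr.envOf, π2, π3, Proj.fstP, Proj.sndP, Proj.comp, ones, Function.update]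

/-! ### The offsets as numeral expressions -/

section Exprs

variable (P)

/-- `oC(L, k) = cBase(L) + k · cW(L)` (`k` the level-`1` index). [folklore] -/
def oCE : NExpr RV := .add (.pol (cBasePoly P) vL) (.mul (.var i1) (.pol (cWPoly P) vL))
/-- `oG(L, k)`. [folklore] -/
def oGE : NExpr RV := .add (.pol (gBasePoly P) vL) (.mul (.var i1) (.pol (copyWPoly P) vL))
/-- `oGT(L, k)`. [folklore] -/
def oGTE : NExpr RV := .add (.pol (gtBasePoly P) vL) (.mul (.var i1) (.pol sigPoly vL))
/-- `oSlot(n, k) = ell n + k · slotW n`. [folklore] -/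
def oSlotE : NExpr RV := .add (.pol ellPoly vN) (.mul (.var i1) (.pol sigPoly vN))
/-- `oZ(L) + k`. [folklore] -/
def oZkE : NExpr RV := .add (.pol (oZPoly P) vL) (.var i1)
/-- The guarded result wire of `V`: `oV + NNV + ((off + t) · A₁ + eA symTrue)` (`t` the level-`2` index). [folklore] -/
def tVE (off : Polynomial ℕ) : NExpr RV :=
  .add (.pol (oVPoly P) vL) (.add (.pol (NNVPoly P) vL)
    (.add (.mul (.add (.pol off vL) (.var i2)) (.cst (A₁ P.MV))) (.cst (eA P.MV (CWrap.symTrue P.MV)))))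
/-- The fallback result wire `oV + NNV`. [folklore] -/
def tV0E : NExpr RV := .add (.pol (oVPoly P) vL) (.pol (NNVPoly P) vL)

variable {P}

/-- Value of `oCE`. [folklore] -/
@[simp] theorem eval_oCE (env : RV → ℕ) : (oCE P).eval env = oC P (env vL) (env i1) := by simp [oCE, oC]
/-- Value of `oGE`. [folklore] -/
@[simp] theorem eval_oGE (env : RV → ℕ) : (oGE P).eval env = oG P (env vL) (env i1) := by simp [oGE, oG]
/-- Value of `oGTE`. [folklore] -/
@[simp] theorem eval_oGTE (env : RV → ℕ) : (oGTE P).eval env = oGT P (env vL) (env i1) := by simp [oGTE, oGT]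
/-- Value of `oSlotE`. [folklore] -/
@[simp] theorem eval_oSlotE (env : RV → ℕ) : (oSlotE).eval env = oSlot (env vN) (env i1) := by simp [oSlotE, oSlot, sig]
/-- Value of `oZkE`. [folklore] -/
@[simp] theorem eval_oZkE (env : RV → ℕ) : (oZkE P).eval env = oZ P (env vL) + env i1 := by simp [oZkE]
/-- Value of `tVE`. [folklore] -/
@[simp] theorem eval_tVE (off : Polynomial ℕ) (env : RV → ℕ) :
    (tVE P off).eval env = oV P (env vL) + resW P.eV P.MV (n0V P (env vL)) (off.eval (env vL) + env i2) (CWrap.symTrue P.MV) := by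
  simp [tVE, resW, NNV, NN]
/-- Value of `tV0E`. [folklore] -/
@[simp] theorem eval_tV0E (env : RV → ℕ) : (tV0E P).eval env = oV P (env vL) + NN P.eV P.MV (n0V P (env vL)) := by
  simp [tV0E, NNV]

end Exprs

/-! ### The two garbage-free blocks -/

section Blocks

variable (P)

/-- The description of the block of `W` at input length `|z|`. [cite: Regev2004, Lemma 3.12 (proof, p. 14: the value f(t, ā) is computed reversibly)] -/
def descW (z : List Bool) : List Bool :=
  ((cleanOps P.eW P.MW (n0W P z.length) []).map (ClOp.map (· + A0 P z.length))).flatMap opBits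

/-- The description of the block of `V` at input length `|z|`. [cite: Bennett1973, §2] -/
def descV (z : List Bool) : List Bool :=
  ((cleanOps P.eV P.MV (n0V P z.length) []).map (ClOp.map (· + oV P z.length))).flatMap opBits

variable {P}

/-- A polynomial of the family index mentions only the family index. [folklore] -/
theorem inUU_polyE (p : Polynomial ℕ) : InUU (CWrap.polyE p (.var .uu)) := fun x hx => by
  have := CWrap.fv_polyE_sub p _ x hx
  simpa [Literature.Computability.Complexity.GExpr.fv] using this

/-- Value of a polynomial of the family index. [folklore] -/
theorem eval_polyE_envU (p : Polynomial ℕ) (u : ℕ) : (CWrap.polyE p (.var .uu)).eval (envU u) = p.eval u := by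
  rw [CWrap.eval_polyE]; simp [Literature.Computability.Complexity.GExpr.eval, envU]

/-- **`descW ∈ FP`.** [cite: AroraBarak2009, §6.2 Def. 6.12 and Remark 6.7] -/
theorem descW_mem_FP : descW P ∈ FP := by
  have h := RevClean.flatMap_opBits_cleanOps_shift_mem_FP (e := P.eW) (M := P.MW) (inUU_polyE (A0Poly P)) (inUU_polyE (n0WPoly P.sizes))
  refine (congrArg (· ∈ FP) (funext fun z => ?_)).mpr h
  rw [descW, eval_polyE_envU, eval_polyE_envU, eval_A0Poly, eval_n0WPoly]

/-- **`descV ∈ FP`.** [cite: AroraBarak2009, §6.2 Def. 6.12 and Remark 6.7] -/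
theorem descV_mem_FP : descV P ∈ FP := by
  have h := RevClean.flatMap_opBits_cleanOps_shift_mem_FP (e := P.eV) (M := P.MV) (inUU_polyE (oVPoly P)) (inUU_polyE (n0VPoly P))
  refine (congrArg (· ∈ FP) (funext fun z => ?_)).mpr h
  rw [descV, eval_polyE_envU, eval_polyE_envU, eval_oVPoly, eval_n0VPoly]

/-- `progW` describes as `descW`. [folklore] -/
theorem flatMap_opBits_progW (z : List Bool) : (progW P z.length).flatMap opBits = descW P z := rfl

/-- `progV` describes as `descV`. [folklore] -/
theorem flatMap_opBits_progV (z : List Bool) : (progV P z.length).flatMap opBits = descV P z := rfl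

variable (P)

/-- The block of `W` read off the level-`1` record. [folklore] -/
def blockW1 : BFn := (BFn.ofFP (descW P) descW_mem_FP).pre (π1 vL)

/-- The block of `V` read off the level-`1` record. [folklore] -/
def blockV1 : BFn := (BFn.ofFP (descV P) descV_mem_FP).pre (π1 vL)

variable {P}

/-- Value of `blockW1`. [folklore] -/
theorem blockW1_fn (z u : List Bool) (k : ℕ) : (blockW1 P).fn (boolPair (boolPair z u) (ones k)) = (progW P z.length).flatMap opBits := by
  rw [flatMap_opBits_progW]; simp [blockW1, π1, Proj.comp, Proj.fstP]

/-- Value of `blockV1`. [folklore] -/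
theorem blockV1_fn (z u : List Bool) (k : ℕ) : (blockV1 P).fn (boolPair (boolPair z u) (ones k)) = (progV P z.length).flatMap opBits := by
  rw [flatMap_opBits_progV]; simp [blockV1, π1, Proj.comp, Proj.fstP]

end Blocks

/-! ### The erase layers: the guarded result wires of `V` -/

section Erase

variable (P)

/-- The numeral of the source wire `tV L (off + t)` of the erase layers, by branching on
`off + t < JJ`. [folklore] -/
def srcV (off : Polynomial ℕ) : BFn :=
  BFn.iteLt ((ucount off (π2 vL)).app (ucount X (π2 i2))) (ucount (JJVPoly P) (π2 vL)) (NExpr.toB π2 (tVE P off)) (NExpr.toB π2 (tV0E P))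

variable {P}

/-- The level-`2` environment over a level-`1` record `⟨⟨z, u⟩, 1ᵏ⟩`. [folklore] -/
theorem envOf_π2_vals (z u : List Bool) (k t : ℕ) :
    NExpr.envOf π2 (boolPair (boolPair (boolPair z u) (ones k)) (ones t)) vL = z.length ∧
      NExpr.envOf π2 (boolPair (boolPair (boolPair z u) (ones k)) (ones t)) vN = u.length ∧
      NExpr.envOf π2 (boolPair (boolPair (boolPair z u) (ones k)) (ones t)) i1 = k ∧
      NExpr.envOf π2 (boolPair (boolPair (boolPair z u) (ones k)) (ones t)) i2 = t := by
  simp [envOf_π2, envOf_π1, Function.update]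

/-- The level-`1` environment over a level-`0` record `⟨z, u⟩`. [folklore] -/
theorem envOf_π1_vals (z u : List Bool) (k : ℕ) :
    NExpr.envOf π1 (boolPair (boolPair z u) (ones k)) vL = z.length ∧ NExpr.envOf π1 (boolPair (boolPair z u) (ones k)) vN = u.length ∧
      NExpr.envOf π1 (boolPair (boolPair z u) (ones k)) i1 = k := by
  simp [envOf_π1, Function.update]

/-- **`srcV` prints the numeral of `tV L (off + t)`.** [folklore] -/
theorem srcV_fn (off : Polynomial ℕ) (z u : List Bool) (k t : ℕ) :
    (srcV P off).fn (boolPair (boolPair (boolPair z u) (ones k)) (ones t)) = encodeNat (tV P z.length (off.eval z.length + t)) := by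
  obtain ⟨h1, -, -, h4⟩ := envOf_π2_vals z u k t
  rw [srcV, BFn.iteLt_fn]
  simp only [BFn.app_fn, ucount_fn, List.length_append, ones, List.length_replicate, NExpr.toB_fn, eval_tVE, eval_tV0E,
    eval_JJVPoly]
  have eL : ((π2 vL).fn (boolPair (boolPair (boolPair z u) (List.replicate k true)) (List.replicate t true))).length = z.length := h1
  have et : ((π2 i2).fn (boolPair (boolPair (boolPair z u) (List.replicate k true)) (List.replicate t true))).length = t := h4
  rw [eL, et, eval_X, h1, h4]
  unfold tV
  split_ifs <;> rfl

end Erase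

/-! ### The body and the initial stage -/

section Body

variable (P)

/-- **The description of `body P L n k`** read off the level-`1` record `⟨⟨1ᴸ, 1ⁿ⟩, 1ᵏ⟩`. [cite: Regev2004, Lemma 3.12 (proof, p. 14: the routine creating one register)] -/
def bodyB : BFn :=
  (swapL π1 π2 i2 (oCE P) (.pol (oIxPoly P) vL) P.pkap vL).app <|
  (swapL π1 π2 i2 (.add (oCE P) (.pol P.pkap vL)) (.pol (oTaPoly P) vL) sigPoly vL).app <|
  (blockW1 P).app <| (blockV1 P).app <|
  (copyLB π1 π2 i2 (srcV P 0) (.pol (oIxPoly P) vL) P.pkap vL).app <|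
  (copyLB π1 π2 i2 (srcV P P.pkap) (.pol (oTPoly P) vL) sigPoly vL).app <|
  (blockV1 P).app <|
  (copyLB π1 π2 i2 (NExpr.toB π2 (.add (.pol (oTPoly P) vL) (.var i2))) (.pol (oTaPoly P) vL) sigPoly vL).app <|
  (swapL π1 π2 i2 (.pol (oTaPoly P) vL) oSlotE sigPoly vN).app <|
  (swapL π1 π2 i2 (.add (.pol (A0Poly P) vL) (.pol (NNWPoly P) vL)) (oGE P) (copyWPoly P) vL).app <|
  (swapL π1 π2 i2 (.pol (oTPoly P) vL) (oGTE P) sigPoly vL).app <|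
  notWord (NExpr.toB π1 (oZkE P))

/-- **The description of `progInit P L n`** read off the level-`0` record `⟨1ᴸ, 1ⁿ⟩`. [cite: Regev2004, Def. 2.1 (the DCP input)] -/
def progInitB : BFn :=
  (swapL π0 π1 i1 (.cst 0) (.pol (oWzPoly P) vL) X vL).app <|
  (notsL π0 π1 i1 (.pol (A0Poly P) vL) X vL).app <|
  (notsL π0 π1 i1 (.pol (oVPoly P) vL) X vL).app <|
  notWord (NExpr.toB π0 (.pol (X * (C 4 * X + 1)) vN))

/-- **The description of the whole program.** [cite: Regev2004, Lemma 3.12 (proof, p. 14)] -/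
def progB : BFn := (progInitB P).app (BFn.layer (bodyB P) (ucount (rmaxPoly P) (π0 vL)))

variable {P}

/-- **`bodyB` prints `body`.** [folklore] -/
theorem bodyB_fn (z u : List Bool) (k : ℕ) :
    (bodyB P).fn (boolPair (boolPair z u) (ones k)) = (body P z.length u.length k).flatMap opBits := by
  obtain ⟨h1, h2, h3⟩ := envOf_π1_vals z u k
  have hW := blockW1_fn (P := P) z u k
  have hV := blockV1_fn (P := P) z u k
  rw [body]
  simp only [List.flatMap_append, bodyB, BFn.app_fn]
  rw [swapL_fn envOf_π2 (by simp [NExpr.vars, NExpr.var, oCE]) (by simp [NExpr.vars]),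
    swapL_fn envOf_π2 (by simp [NExpr.vars, NExpr.var, oCE]) (by simp [NExpr.vars]),
    hW, hV,
    copyLB_fn envOf_π2 (fun t => srcV_fn 0 z u k t) (by simp [NExpr.vars]),
    copyLB_fn envOf_π2 (fun t => srcV_fn P.pkap z u k t) (by simp [NExpr.vars]),
    copyLB_fn envOf_π2 (src := fun t => oT P z.length + t) (fun t => by
      rw [NExpr.toB_fn]; obtain ⟨e1, -, -, e4⟩ := envOf_π2_vals z u k t; simp [e1, e4]) (by simp [NExpr.vars]),
    swapL_fn envOf_π2 (by simp [NExpr.vars]) (by simp [NExpr.vars, NExpr.var, oSlotE]),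
    swapL_fn envOf_π2 (by simp [NExpr.vars]) (by simp [NExpr.vars, NExpr.var, oGE]),
    swapL_fn envOf_π2 (by simp [NExpr.vars]) (by simp [NExpr.vars, NExpr.var, oGTE]),
    notWord_apply (p := oZ P z.length + k) (by rw [NExpr.toB_fn, eval_oZkE, h1, h3])]
  simp only [NExpr.eval_add', NExpr.eval_pol, eval_oCE, eval_oGE, eval_oGTE, eval_oSlotE, h1, h2, h3, eval_oIxPoly, eval_oTaPoly,
    eval_oTPoly, eval_A0Poly, eval_NNWPoly, eval_copyWPoly, eval_sigPoly]
  simp only [progEix, progET, progEta, eval_zero, Nat.zero_add, List.append_assoc, List.flatMap_cons, List.flatMap_nil, List.append_nil]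
  rfl

/-- **`progInitB` prints `progInit`.** [folklore] -/
theorem progInitB_fn (z u : List Bool) : (progInitB P).fn (boolPair z u) = (progInit P z.length u.length).flatMap opBits := by
  rw [progInit]
  simp only [List.flatMap_append, progInitB, BFn.app_fn]
  rw [swapL_fn envOf_π1 (by simp [NExpr.vars]) (by simp [NExpr.vars]), notsL_fn envOf_π1 (by simp [NExpr.vars]),
    notsL_fn envOf_π1 (by simp [NExpr.vars]),
    notWord_apply (p := ell u.length - 1) (by rw [NExpr.toB_fn, NExpr.eval_pol, envOf_π0_vN]; simp [ell])]
  simp only [NExpr.eval_cst, NExpr.eval_pol, envOf_π0_vL, eval_oWzPoly, eval_A0Poly, eval_oVPoly, eval_X, List.flatMap_cons,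
    List.flatMap_nil, List.append_nil, List.append_assoc]
  rfl

/-- The register loop prints the bodies. [folklore] -/
theorem layer_bodyB_fn (z u : List Bool) :
    (BFn.layer (bodyB P) (ucount (rmaxPoly P) (π0 vL))).fn (boolPair z u) =
      ((List.range (rmax P z.length)).flatMap (body P z.length u.length)).flatMap opBits := by
  have hc : ((ucount (rmaxPoly P) (π0 vL)).fn (boolPair z u)).length = rmax P z.length := by
    rw [length_ucount_fn, envOf_π0_vL, eval_rmaxPoly]
  rw [BFn.layer_fn, hc, List.flatMap_assoc, CWrap.flatMap_range_eq_ccat]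
  exact ccat_congr fun k _ => bodyB_fn z u k

/-- **`progB` prints `prog`.** [cite: AroraBarak2009, §6.2 Def. 6.12 and Remark 6.7 (descriptions printed in polynomial time)] -/
theorem progB_fn (z u : List Bool) : (progB P).fn (boolPair z u) = (prog P z.length u.length).flatMap opBits := by
  rw [prog, List.flatMap_append, ← layer_bodyB_fn, ← progInitB_fn]
  exact BFn.app_fn _ _ _

end Body


/-! ### The Hadamard layer -/

section HLayer

variable (P)

/-- The wire of digit field `i`, bit `b` of coin zone `k`: `oC k + (kap + 1) + i (4n + 1) + b` (`i` the level-`2`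
index, `b` the level-`3` index added by the layer). [cite: Regev2004, Lemma 3.12 (proof, p. 14: ā ∈ {0,…,M−1}ⁿ)] -/
def digitE : NExpr RV := .add (.add (oCE P) (.pol (P.pkap + 1) vL)) (.mul (.var i2) (.pol (C 4 * X + 1) vN))

/-- The Hadamard words of coin zone `k`, read off the level-`1` record. [cite: NielsenChuang2010, §1.4.4 (H^{⊗n}|0⟩)] -/
def hZoneB : BFn :=
  (hL π1 π2 i2 (oCE P) (P.pkap + 1) vL).app (BFn.layer (hL π2 π3 i3 (digitE P) (C 4 * X) vN) (ucount X (π1 vN)))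

/-- **The description of the Hadamard layer**, read off the level-`0` record. [cite: Regev2004, Lemma 3.12 (proof, p. 14: the uniform superposition)] -/
def hB : BFn :=
  (BFn.layer (hZoneB P) (ucount (rmaxPoly P) (π0 vL))).app (hL π0 π1 i1 (.pol (oGzPoly P) vL) P.pgam vL)

variable {P}

/-- Value of `digitE`. [folklore] -/
@[simp] theorem eval_digitE (env : RV → ℕ) :
    (digitE P).eval env = oC P (env vL) (env i1) + (kap P (env vL) + 1) + env i2 * (4 * env vN + 1) := by
  simp [digitE, kap]

/-- The `ix`/control part of `hZoneB`. [folklore] -/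
theorem hZoneB_fn_ix (z u : List Bool) (k : ℕ) :
    (hL π1 π2 i2 (oCE P) (P.pkap + 1) vL).fn (boolPair (boolPair z u) (ones k)) =
      ((List.range (kap P z.length + 1)).map fun j => oC P z.length k + j).flatMap fun p => gateBits 0 1 [p] := by
  obtain ⟨h1, -, h3⟩ := envOf_π1_vals z u k
  rw [hL_fn envOf_π2 (by simp [NExpr.vars, NExpr.var, oCE]), List.flatMap_map, CWrap.flatMap_range_eq_ccat, eval_oCE, h1, h3,
    eval_add, eval_one, show P.pkap.eval z.length = kap P z.length from rfl]

/-- The digit part of `hZoneB`, one field. [folklore] -/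
theorem hZoneB_fn_digit (z u : List Bool) (k i : ℕ) :
    (hL π2 π3 i3 (digitE P) (C 4 * X) vN).fn (boolPair (boolPair (boolPair z u) (ones k)) (ones i)) =
      ((List.range (4 * u.length)).map fun b => oC P z.length k + (kap P z.length + 1) + i * (4 * u.length + 1) + b).flatMap
        fun p => gateBits 0 1 [p] := by
  obtain ⟨e1, e2, e3, e4⟩ := envOf_π2_vals z u k i
  rw [hL_fn envOf_π3 (by simp [NExpr.vars, NExpr.var, digitE, oCE]), List.flatMap_map, CWrap.flatMap_range_eq_ccat, eval_digitE,
    e1, e2, e3, e4, eval_mul, eval_C, eval_X]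

/-- **`hZoneB` prints the Hadamard words of `coinPosZone`.** [folklore] -/
theorem hZoneB_fn (z u : List Bool) (k : ℕ) :
    (hZoneB P).fn (boolPair (boolPair z u) (ones k)) = (coinPosZone P z.length u.length k).flatMap fun p => gateBits 0 1 [p] := by
  obtain ⟨-, h2, -⟩ := envOf_π1_vals z u k
  have hc : ((ucount X (π1 vN)).fn (boolPair (boolPair z u) (ones k))).length = u.length := by rw [length_ucount_fn, h2, eval_X]
  rw [coinPosZone, List.flatMap_append, hZoneB, BFn.app_fn, hZoneB_fn_ix, BFn.layer_fn, hc, List.flatMap_assoc,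
    CWrap.flatMap_range_eq_ccat (fun i => ((List.range (4 * u.length)).map fun b =>
      oC P z.length k + (kap P z.length + 1) + i * (4 * u.length + 1) + b).flatMap fun p => gateBits 0 1 [p])]
  exact congrArg₂ (· ++ ·) rfl (ccat_congr fun i _ => hZoneB_fn_digit z u k i)

/-- **`hB` prints the Hadamard words of `coinPos`.** [folklore] -/
theorem hB_fn (z u : List Bool) : (hB P).fn (boolPair z u) = (coinPos P z.length u.length).flatMap fun p => gateBits 0 1 [p] := by
  have hc : ((ucount (rmaxPoly P) (π0 vL)).fn (boolPair z u)).length = rmax P z.length := by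
    rw [length_ucount_fn, envOf_π0_vL, eval_rmaxPoly]
  rw [coinPos, List.flatMap_append, hB, BFn.app_fn, BFn.layer_fn, hc, List.flatMap_assoc, CWrap.flatMap_range_eq_ccat,
    hL_fn envOf_π1 (by simp [NExpr.vars]), List.flatMap_map, CWrap.flatMap_range_eq_ccat, NExpr.eval_pol, envOf_π0_vL, eval_oGzPoly,
    show P.pgam.eval z.length = gam P z.length from rfl]
  exact congrArg₂ (· ++ ·) (ccat_congr fun k _ => hZoneB_fn z u k) rfl

/-- **The Hadamard layer of the circuit describes as the words of `coinPos`.** [folklore] -/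
theorem flatMap_gateEnc_hGates (L : ℕ) : (hGates P L).flatMap gateEnc = (coinPos P L (nOf L)).flatMap fun p => gateBits 0 1 [p] := by
  rw [hGates, coinFin, List.map_map, List.flatMap_map]
  refine List.flatMap_congr fun p hp => ?_
  have hlt : p < L + anc P L := by rw [add_anc]; exact (coinPos_bounds (nOf_le L) hp).2
  exact (gateEnc_hOn _).trans (by rw [val_finOf_of_lt _ hlt])

end HLayer

/-! ### The preprocessor, the solver, the ancillas, the assembly -/

section Assembly

/-- `1^{⌊√L⌋²}` from `1ᴸ` (along the ruler `1ᴸ`). [folklore] -/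
def sqUF : List Bool → List Bool := binToUnaryFn ∘ fanoutFn (fun z => z) (prodFn ∘ fanoutFn isqrtFn isqrtFn)

/-- Value of `sqUF`. [folklore] -/
theorem sqUF_apply (z : List Bool) : sqUF z = ones (Nat.sqrt z.length ^ 2) := by
  simp only [sqUF, Function.comp_apply, fanoutFn_apply, prodFn_boolPair, isqrtFn_apply, bitsToNat_encodeNat, binToUnaryFn_boolPair,
    bitsToNat_encodeNat, pow_two]
  rw [min_eq_left (Nat.sqrt_le z.length)]

/-- `sqUF ∈ FP`. [folklore] -/
theorem sqUF_mem_FP : sqUF ∈ FP :=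
  comp_mem_FP binToUnaryFn_mem_FP (fanoutFn_mem_FP (PolyTimeComputable.id _)
    (comp_mem_FP prodFn_mem_FP (fanoutFn_mem_FP isqrtFn_mem_FP isqrtFn_mem_FP)))

/-- **The preprocessor** `1ᴸ ↦ ⟨1ᴸ, 1ⁿ⟩`, `n = nOf L = L − ⌊√L⌋²`. [folklore] -/
def prepF : List Bool → List Bool := fanoutFn (fun z => z) (polyFn X ∘ dropFn ∘ fanoutFn sqUF (fun z => z))

/-- Value of `prepF`. [folklore] -/
theorem prepF_apply (z : List Bool) : prepF z = boolPair z (ones (nOf z.length)) := by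
  simp only [prepF, fanoutFn_apply, Function.comp_apply, sqUF_apply, dropFn_boolPair, polyFn_apply, eval_X, List.length_drop, ones,
    List.length_replicate, nOf]

/-- `prepF ∈ FP`. [folklore] -/
theorem prepF_mem_FP : prepF ∈ FP :=
  fanoutFn_mem_FP (PolyTimeComputable.id _) (comp_mem_FP (polyFn_mem_FP X) (comp_mem_FP dropFn_mem_FP
    (fanoutFn_mem_FP sqUF_mem_FP (PolyTimeComputable.id _))))

variable (P)

/-- **The solver's description**, read off the level-`0` record: its own description function at `1^{ell n}`. [cite: Regev2004, Lemma 3.12 (proof, p. 14: "It then calls the two point algorithm")] -/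
def solvF : List Bool → List Bool := sndF ∘ sndF ∘ P.FD.descFn ∘ polyFn ellPoly ∘ sndF

/-- The ancilla count in unary: `1^{Wtot L}` with the first `L` symbols dropped. [folklore] -/
def ancOnesF : List Bool → List Bool := dropFn ∘ fanoutFn (fun z => z) (polyFn (WtotPoly P))

/-- **The whole description function.** [cite: AroraBarak2009, §6.2 Def. 6.12 and Remark 6.7] -/
def descTot : List Bool → List Bool :=
  fanoutFn lenBinF (fanoutFn (ancOnesF P) (appF ∘ fanoutFn ((hB P).fn ∘ prepF) (appF ∘ fanoutFn ((progB P).fn ∘ prepF) (solvF P ∘ prepF))))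

variable {P}

/-- Value of `solvF`. [folklore] -/
theorem solvF_apply (z u : List Bool) : solvF P (boolPair z u) = (P.FD.circ (ell u.length)).encode := by
  simp only [solvF, Function.comp_apply, sndF_boolPair, polyFn_apply, eval_ellPoly, CWrap.sndF_sndF_descFn]
  rw [show (ones (ell u.length)).length = ell u.length by simp [ones]]

/-- `solvF ∈ FP` for a uniform solver. [folklore] -/
theorem solvF_mem_FP (hU : P.FD.IsUniform) : solvF P ∈ FP :=
  comp_mem_FP sndF_mem_FP (comp_mem_FP sndF_mem_FP (comp_mem_FP (QCircuitFamily.descFn_mem_FP_of_isUniform hU)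
    (comp_mem_FP (polyFn_mem_FP _) sndF_mem_FP)))

/-- Value of `ancOnesF`. [folklore] -/
theorem ancOnesF_apply (z : List Bool) : ancOnesF P z = unaryEncodeNat (anc P z.length) := by
  simp only [ancOnesF, Function.comp_apply, fanoutFn_apply, dropFn_boolPair, polyFn_apply, eval_WtotPoly, ones, List.drop_replicate, anc]
  exact (RevDesc.unaryEncodeNat_eq_replicate _).symm

/-- `ancOnesF ∈ FP`. [folklore] -/
theorem ancOnesF_mem_FP : ancOnesF P ∈ FP := comp_mem_FP dropFn_mem_FP (fanoutFn_mem_FP (PolyTimeComputable.id _) (polyFn_mem_FP _))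

/-- `descTot ∈ FP` for a uniform solver. [folklore] -/
theorem descTot_mem_FP (hU : P.FD.IsUniform) : descTot P ∈ FP :=
  fanoutFn_mem_FP lenBinF_mem_FP (fanoutFn_mem_FP ancOnesF_mem_FP (comp_mem_FP appF_mem_FP (fanoutFn_mem_FP (comp_mem_FP (hB P).mem prepF_mem_FP)
    (comp_mem_FP appF_mem_FP (fanoutFn_mem_FP (comp_mem_FP (progB P).mem prepF_mem_FP) (comp_mem_FP (solvF_mem_FP hU) prepF_mem_FP))))))

/-- The solver's gates describe as its circuit, verbatim. [cite: AroraBarak2009, §6.2 (a circuit for each input length, hard-wired)] -/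
theorem flatMap_gateEnc_solverGates (L : ℕ) : (solverGates P L).flatMap gateEnc = (P.FD.circ (ell (nOf L))).encode := by
  rw [solverGates, show (P.FD.circ (ell (nOf L))).encode = QCircuit.encode (⟨(P.FD.circ (ell (nOf L))).gates⟩ : QCircuit cliffordT _) from rfl,
    encode_eq_flatMap]
  simp only [mapWires, List.flatMap_map]
  exact List.flatMap_congr fun g _ => CWrap.gateEnc_mapWiresGate_castLEEmb _ g

/-- The compiled program describes as `prog`. [folklore] -/
theorem flatMap_gateEnc_clampR (L : ℕ) : (revCompile (clampR P L)).flatMap gateEnc = (prog P L (nOf L)).flatMap opBits :=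
  flatMap_gateEnc_revCompile_toRevList (width_pos L) _ (fun op hop => prog_lt' (nOf_le L) op hop) _

/-- **The description function of the family is `descTot`.** [folklore] -/
theorem descFn_eq_descTot (z : List Bool) : (family P).descFn z = descTot P z := by
  rw [QCircuitFamily.descFn_eq, descTot, fanoutFn_apply, fanoutFn_apply, lenBinF_apply, ancOnesF_apply]
  simp only [Function.comp_apply, fanoutFn_apply, appF_boolPair, prepF_apply, hB_fn, progB_fn, solvF_apply]
  rw [show (ones (nOf z.length)).length = nOf z.length by simp [ones]]
  congr 2
  change QCircuit.encode (⟨hGates P z.length ++ revCompile (clampR P z.length) ++ solverGates P z.length⟩ : QCircuit cliffordT _) = _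
  rw [encode_eq_flatMap, List.flatMap_append, List.flatMap_append, flatMap_gateEnc_hGates, flatMap_gateEnc_clampR,
    flatMap_gateEnc_solverGates, List.append_assoc]

/-- **The family of the routine is polynomial-time uniform** (for a polynomial-time uniform solver).
[cite: Regev2004, Thm. 1.1 (proof: the algorithm runs in quantum polynomial time) with AroraBarak2009, §6.2 Def. 6.12 and Remark 6.7] -/
theorem family_isUniform (hU : P.FD.IsUniform) : (family P).IsUniform := by
  refine QCircuitFamily.isUniform_of_descFn_mem_FP ?_
  rw [show (family P).descFn = descTot P from funext descFn_eq_descTot]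
  exact descTot_mem_FP hU

end Assembly

end RegevRoutine

end Literature.Algebra.EuclideanLattices

end
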